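import Summits.BirchSwinnertonDyer.Rank1Residual.Ordinary.Conjectures.KuriharaExactOrderRankOneAt3
import Literature.NumberTheory.EllipticCurves.PAdicGrossZagierConstantTermProofs
import HarnessLib

/-!
# C-16 (the rank-one Kurihara exact-order law at `p = 3`) pins Kim's divisibility index per level and
# the first `∂`-invariant: `∂^{(1)}(δ̃) = v₃ #Ш_an + v₃ ∏ c_q` (PROVED implications; C-16 is the HYPOTHESIS)

HONEST FRAMING (cell `b2b-bsdres`, run/shared/lean/b2b/bsd-rank1-residual/, verbatim in every
file): the goal of the cell is to DELETE the COMBINATION-SHAPED residual classes of the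
Birch–Swinnerton-Dyer formula for ALL analytic-rank `≤ 1` elliptic curves over `ℚ` — "full BSD
formula for every rank `≤ 1` curve in class `C`" assembled STRICTLY from published theorems — so
that the rank-`≤ 1` remainder becomes exactly the CONSTRUCTION-SHAPED classes, which are TYPED
(missing-input `Prop`s), NOT attempted. This is not "finishing BSD". Seat `b2b-bsdres-additive-p3`
(typer-designate for C-16, hyp R-16 (e)). THEOREMS ONLY: every statement below takes the cell conjecture
C-16 — in its per-prime form "`KuriharaExactOrderAt W D.f ℓ k P F` at every depth `k` with `ℓ ∈ 𝒫_k`",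
which is what `KuriharaExactOrderRankOneAtThree` asserts for a curve of its letter — as a HYPOTHESIS and
reads it in the `∂`-vocabulary of Kim 2022 already in the tree (`KuriharaNumberInvariants.lean`:
`KuriharaDivisibleAt`, `kuriharaDivIndex`, `kuriharaPartial`). Nothing is asserted about any curve; no
Literature fact; nothing booked; X7 / X8 stay CONSTRUCTION-SHAPED; C-16 stays a CONJECTURE
(data-suggested, never theorem).

## What is proved

For a cyclic Kolyvagin prime `ℓ` of `(E, 3)` with `k′_ℓ` its largest depth (`ℓ ∈ 𝒫_{k′}`), floor `F` and
`v = v_ℓ(P) = localDivExponent W 3 ℓ P`, ASSUMING the law at `ℓ` at every depth: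
* `kuriharaDivisibleAt_of_forall_kuriharaExactOrderAt`: `δ̃_ℓ ∈ 3^j ℤ₃/I_ℓ` for every `j ≤ F + 2v`;
* `not_kuriharaDivisibleAt_of_forall_kuriharaExactOrderAt`: `δ̃_ℓ ∉ 3^{F+2v+1} ℤ₃/I_ℓ` when `F + 2v < k′_ℓ`;
* `kuriharaDivIndex_eq_of_forall_kuriharaExactOrderAt`: hence Kim's divisibility index of `δ̃_ℓ` is
  EXACTLY `F + 2·v_ℓ(P)` when `F + 2v < k′_ℓ` (and `⊤` is not excluded otherwise — the capped case);
* `kuriharaPartial_one_eq_of_forall_kuriharaExactOrderAt`: if the law holds at EVERY cyclic Kolyvagin prime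
  of `(E, 3)` (what C-16 says for one curve) and ONE such prime has `v_ℓ(P) = 0` and `k′_ℓ > F` (such primes
  have Chebotarev density `2/3` — NOT proved here; the prime is a hypothesis), then Kim's first invariant is
  **`∂^{(1)}(δ̃) = F`**; `kuriharaPartial_one_eq_floor_of_kuriharaExactOrderRankOne` is the same from the
  closed sentence `KuriharaExactOrderRankOneAtThree` with `F = v₃ #Ш_an + v₃ ∏ c_q`.
* `kuriharaVanishingOrder_eq_one_of_forall_kuriharaExactOrderAt` / `…_of_kuriharaExactOrderRankOne`: with the
  same witness prime, **`ord(δ̃) = 1`** (`= r_an`; the level `1` number `δ̃_1 = L(E,1)/Ω⁺ = 0` vanishes to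
  every depth in analytic rank `1` — tree theorems `analyticRank_eq_zero_iff_holds`,
  `ratPlusSymbol_zero_eq_zero_of_entireLFunction_eq_zero` — and the witness level is `ν = 1`).
* `zmodPowOrd_kuriharaNumber_mod_two_of_kuriharaExactOrderAt`: the PARITY probe — below the cap the exact order
  is `≡ F (mod 2)` (hyp §120, K-hyp-4's cheapest partial probe).
READING (not claimed as a theorem anywhere in the tree at `p = 3`): Kim 2022 Thm. 1.9 (6) in analytic rank
one (`ord(δ̃) = 1`) says `length Ш(E/ℚ)[p^∞] = ∂^{(1)}(δ̃) − ∂^{(∞)}(δ̃)` and Conj. 1.10 says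
`∂^{(∞)}(δ̃) = v_p ∏ c_q`; so ON ITS LETTER C-16 + Conj. 1.10 + Thm. 1.9 (all three OPEN or out of printed
range at `p = 3`) would give `length Ш[3^∞] = v₃ #Ш_an`, the `Ш`-part of `BSD(E, 3)` — which is why the
cell reads the law as a STRUCTURE datum and books nothing from it.

References: C.-H. Kim, Amer. J. Math. 148 (2026) = arXiv:2203.12159, §1.5.1, Def. 2.13, Thm. 1.9, Conj. 1.10
[Kim2022StructureSelmer]; hyp `SHARPENED-CONJECTURES.md` §120; lit `STRUCTURE.md` §2 C-16; additive-p3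
`R1-DEPTH-LAW.md` §1–§5.
-/

noncomputable section

open scoped Classical MatrixGroups ModularForm

open CongruenceSubgroup WeierstrassCurve Literature.NumberTheory.EllipticCurves
  Literature.NumberTheory.EllipticCurves.ModularForms
  Literature.NumberTheory.EllipticCurves.Rank1Residual

namespace Summit.BirchSwinnertonDyer.Rank1Residual.Ordinary

section PerPrime

variable (W : WeierstrassCurve ℚ) [W.IsGloballyMinimal] {N : ℕ} (f : CuspForm (Gamma0 N) 2)
  (ℓ : ℕ) [Fact ℓ.Prime] (P : W.toAffine.Point) (F : ℕ)

/-- **The law at `ℓ` at every depth makes `δ̃_ℓ` divisible by `3^j` for every `j ≤ F + 2·v_ℓ(P)`** (in the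
tree's `KuriharaDivisibleAt W 3 f ℓ j`: the mod-`3^k` numbers vanish for every `k ≤ j` with `ℓ ∈ 𝒩_k`).
[cite: Kim2022StructureSelmer, §1.5.1 (PDF p. 7) and Def. 2.13 (PDF p. 14)] -/
theorem kuriharaDivisibleAt_of_forall_kuriharaExactOrderAt
    (hlaw : ∀ k, 1 ≤ k → Kato.IsKolyvaginPrime W 3 k ℓ → KuriharaExactOrderAt W f ℓ k P F)
    {j : ℕ} (hj : j ≤ F + 2 * localDivExponent W 3 ℓ P) : KuriharaDivisibleAt W 3 f ℓ j := by
  have hℓp : ℓ.Prime := Fact.out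
  intro k hk hkprod ψ hψ
  rcases Nat.eq_zero_or_pos k with rfl | hpos
  · haveI : Subsingleton (ZMod (3 ^ 0)) := ZMod.subsingleton_iff.mpr (pow_zero 3)
    exact Subsingleton.elim _ _
  · have hprime : Kato.IsKolyvaginPrime W 3 k ℓ := hkprod.isKolyvaginPrime hℓp dvd_rfl
    have h := hlaw k hpos hprime ψ hψ
    rw [min_eq_left (hk.trans hj)] at h
    exact (zmodPowOrd_eq_iff_eq_zero (by norm_num) _).mp h

/-- **… and NOT divisible by `3^{F + 2·v_ℓ(P) + 1}` when `F + 2·v_ℓ(P) < k′_ℓ`** (`ℓ ∈ 𝒫_{k′}`): at depth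
`k = F + 2v + 1 ≤ k′` the law gives a non-zero number. [cite: Kim2022StructureSelmer, §1.5.1 (PDF p. 7) and Def. 2.13 (PDF p. 14)] -/
theorem not_kuriharaDivisibleAt_of_forall_kuriharaExactOrderAt
    (hlaw : ∀ k, 1 ≤ k → Kato.IsKolyvaginPrime W 3 k ℓ → KuriharaExactOrderAt W f ℓ k P F)
    {k' : ℕ} (hk' : Kato.IsKolyvaginPrime W 3 k' ℓ) (hlt : F + 2 * localDivExponent W 3 ℓ P < k') :
    ¬ KuriharaDivisibleAt W 3 f ℓ (F + 2 * localDivExponent W 3 ℓ P + 1) := by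
  have hℓp : ℓ.Prime := Fact.out
  haveI : NeZero ℓ := ⟨hℓp.ne_zero⟩
  set m := F + 2 * localDivExponent W 3 ℓ P with hm
  intro hdiv
  have hk : Kato.IsKolyvaginPrime W 3 (m + 1) ℓ := hk'.mono (by omega)
  -- a surjective discrete logarithm modulo `3^(m+1)`
  have hdvd1 : 3 ^ (m + 1) ∣ ℓ - 1 := (Nat.modEq_iff_dvd' hℓp.one_lt.le).mp hk.modEq_one.symm
  obtain ⟨ψ', hψ'⟩ := exists_surjective_unitsHom hℓp hdvd1
  let Ψ : (q : ℕ) → (ZMod q)ˣ →* Multiplicative (ZMod (3 ^ (m + 1))) :=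
    Function.update (fun q => (1 : (ZMod q)ˣ →* Multiplicative (ZMod (3 ^ (m + 1))))) ℓ ψ'
  have hΨℓ : Ψ ℓ = ψ' := Function.update_self ..
  have hΨ : ∀ q ∈ ℓ.primeFactors, Function.Surjective (Ψ q) := by
    intro q hq
    rw [Nat.Prime.primeFactors hℓp, Finset.mem_singleton] at hq
    subst hq
    rw [hΨℓ]
    exact hψ'
  have h0 : kuriharaNumber f (3 ^ (m + 1)) ℓ Ψ = 0 := hdiv (m + 1) le_rfl hk.isKolyvaginProduct Ψ hΨ
  have h := hlaw (m + 1) (by omega) hk Ψ hΨ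
  rw [h0, zmodPowOrd_zero, min_eq_right (by omega)] at h
  omega

/-- **C-16 pins Kim's divisibility index per level: `kuriharaDivIndex W 3 f ℓ = F + 2·v_ℓ(P)`** whenever
`F + 2·v_ℓ(P) < k′_ℓ` (the uncapped levels; at the capped ones the index is `⊤`, `δ̃_ℓ = 0` in `ℤ₃/I_ℓ`).
[cite: Kim2022StructureSelmer, §2.5.1 (PDF p. 13) and Def. 2.13 (PDF p. 14)] -/
theorem kuriharaDivIndex_eq_of_forall_kuriharaExactOrderAt
    (hlaw : ∀ k, 1 ≤ k → Kato.IsKolyvaginPrime W 3 k ℓ → KuriharaExactOrderAt W f ℓ k P F)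
    {k' : ℕ} (hk' : Kato.IsKolyvaginPrime W 3 k' ℓ) (hlt : F + 2 * localDivExponent W 3 ℓ P < k') :
    kuriharaDivIndex W 3 f ℓ = ((F + 2 * localDivExponent W 3 ℓ P : ℕ) : ℕ∞) := by
  set m := F + 2 * localDivExponent W 3 ℓ P with hm
  refine le_antisymm ?_ (le_kuriharaDivIndex_of_divisibleAt W 3 f
    (kuriharaDivisibleAt_of_forall_kuriharaExactOrderAt W f ℓ P F hlaw le_rfl))
  rw [kuriharaDivIndex_def]
  refine iSup₂_le fun j hj => ?_
  by_contra hlt'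
  have hmj : m + 1 ≤ j := by
    have : ¬ (j : ℕ∞) ≤ (m : ℕ∞) := hlt'
    have : m < j := by
      by_contra h; exact this (by exact_mod_cast not_lt.mp h)
    omega
  exact not_kuriharaDivisibleAt_of_forall_kuriharaExactOrderAt W f ℓ P F hlaw hk' hlt (hj.anti hmj)

end PerPrime

section Partial

variable (W : WeierstrassCurve ℚ) [W.IsGloballyMinimal] {N : ℕ} (f : CuspForm (Gamma0 N) 2)
  (P : W.toAffine.Point) (F : ℕ)

/-- A square-free natural number with exactly one prime factor is that prime. [folklore] -/
theorem eq_of_squarefree_of_primeFactors_eq_singleton {n q : ℕ} (hn : Squarefree n)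
    (h : n.primeFactors = {q}) : n = q := by
  have hq : q ∈ n.primeFactors := by rw [h]; exact Finset.mem_singleton_self q
  have hqp : q.Prime := Nat.prime_of_mem_primeFactors hq
  have hqn : q ∣ n := Nat.dvd_of_mem_primeFactors hq
  have huniq : ∀ {d : ℕ}, d.Prime → d ∣ n → d = q := fun hd hdn => by
    have : _ ∈ n.primeFactors := Nat.mem_primeFactors.mpr ⟨hd, hdn, hn.ne_zero⟩
    rw [h, Finset.mem_singleton] at this
    exact this
  have h1 := Nat.eq_prime_pow_of_unique_prime_dvd hn.ne_zero huniq
  set L := n.primeFactorsList.length with hL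
  have hL0 : L ≠ 0 := by
    intro h0
    rw [h0, pow_zero] at h1
    rw [h1] at hqn
    exact hqp.one_lt.ne' (Nat.dvd_one.mp hqn)
  have hsq : Squarefree (q ^ L) := by rw [← h1]; exact hn
  have hL1 : L = 1 := ((Nat.squarefree_pow_iff hqp.one_lt.ne' hL0).mp hsq).2
  rw [hL1, pow_one] at h1
  exact h1

/-- **C-16 pins Kim's first invariant: `∂^{(1)}(δ̃) = F`.** If the law holds with floor `F` at EVERY cyclic
Kolyvagin prime of `(E, 3)` at every depth (what `KuriharaExactOrderRankOneAtThree` says for one curve of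
its letter), and ONE cyclic Kolyvagin prime `ℓ` has `v_ℓ(P) = 0` and `k′_ℓ > F` (`ℓ ∈ 𝒫_{F+1}`; such primes
exist with Chebotarev density `2/3` among the cyclic Kolyvagin primes — a HYPOTHESIS here), then
`kuriharaPartial W 3 f 1 = F`: every cyclic `ν = 1` level is a cyclic Kolyvagin PRIME `ℓ′` with index
`≥ F` (`min(k, F + 2v′) = k` for `k ≤ F`), and the witness has index exactly `F`.
[cite: Kim2022StructureSelmer, §1.5.1 (PDF p. 7), Def. 2.13 and Thm. 2.14 (PDF p. 14)] -/
theorem kuriharaPartial_one_eq_of_forall_kuriharaExactOrderAt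
    (hall : ∀ (ℓ : ℕ) (hℓ : ℓ.Prime), IsCyclicKolyvaginLevel W 3 ℓ → ∀ k, 1 ≤ k →
      Kato.IsKolyvaginPrime W 3 k ℓ → @KuriharaExactOrderAt W _ N f ℓ ⟨hℓ⟩ k P F)
    {ℓ : ℕ} [Fact ℓ.Prime] (hcyc : IsCyclicKolyvaginLevel W 3 ℓ) (hF : Kato.IsKolyvaginPrime W 3 (F + 1) ℓ)
    (hv : localDivExponent W 3 ℓ P = 0) : kuriharaPartial W 3 f 1 = (F : ℕ∞) := by
  have hℓp : ℓ.Prime := Fact.out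
  refine le_antisymm ?_ ?_
  · -- the witness level `ℓ`: index exactly `F`
    have hcard : ℓ.primeFactors.card = 1 := by rw [hℓp.primeFactors, Finset.card_singleton]
    refine (kuriharaPartial_le W 3 f hcyc hcard).trans (le_of_eq ?_)
    have hlaw := hall ℓ hℓp hcyc
    have h := kuriharaDivIndex_eq_of_forall_kuriharaExactOrderAt W f ℓ P F hlaw hF (by rw [hv]; omega)
    rw [h, hv, mul_zero, add_zero]
  · -- every cyclic `ν = 1` level has index `≥ F`
    rw [kuriharaPartial_def]
    refine le_iInf fun n => le_iInf fun hn => le_iInf fun hcard => ?_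
    obtain ⟨q, hq⟩ := Finset.card_eq_one.mp hcard
    have hnq : n = q := eq_of_squarefree_of_primeFactors_eq_singleton hn.1.squarefree hq
    subst hnq
    have hqp : n.Prime := Nat.prime_of_mem_primeFactors (by rw [hq]; exact Finset.mem_singleton_self n)
    haveI : Fact n.Prime := ⟨hqp⟩
    have hlaw := hall n hqp hn
    exact le_kuriharaDivIndex_of_divisibleAt W 3 f
      (kuriharaDivisibleAt_of_forall_kuriharaExactOrderAt W f n P F hlaw (Nat.le_add_right F _))

end Partial

section Closed

/-- **From the closed sentence: C-16 ⟹ `∂^{(1)}(δ̃) = v₃ #Ш_an + v₃ ∏ c_q`** on every curve of its letter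
that has a cyclic Kolyvagin prime `ℓ ∈ 𝒫_{F+1}` with `v_ℓ(P) = 0` (a hypothesis; Chebotarev-dense).
With Kim 2022 Thm. 1.9 (6) (`length Ш[p^∞] = ∂^{(1)} − ∂^{(∞)}` in analytic rank one) and Conj. 1.10
(`∂^{(∞)} = v_p ∏ c_q`) — both OPEN / out of printed range at `p = 3` — this READS `length Ш[3^∞] =
v₃ #Ш_an`; nothing of the kind is asserted. [cite: Kim2022StructureSelmer, §1.5.1 (PDF p. 7), Thm. 1.9 (6) and Conj. 1.10 (PDF p. 8)] -/
theorem kuriharaPartial_one_eq_floor_of_kuriharaExactOrderRankOne (hC : KuriharaExactOrderRankOneAtThree)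
    (W : WeierstrassCurve ℚ) [W.IsElliptic] [W.IsGloballyMinimal] (hr : W.analyticRank = 1)
    (P : W.toAffine.Point) (hP : ¬ IsOfFinAddOrder P)
    (hgen : ∀ Q : W.toAffine.Point, ∃ n : ℤ, IsOfFinAddOrder (Q - n • P))
    (htors : ∀ T : W.toAffine.Point, 3 • T = 0 → T = 0) (hsurj : W.HasSurjectiveModNGaloisRep 3)
    (hgood : W.HasGoodReductionAtPrime 3) (ha1 : W.frobeniusTrace 3 ≠ 1) (ha2 : W.frobeniusTrace 3 ≠ -2)
    (hm : ¬ O5.PointLocallyThreeDivisibleAt W 3 P) {q : ℚ} {s : ℕ} (hq : shaAn W = (q : ℂ))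
    (hs : padicValRat 3 q = s) {N : ℕ} [NeZero N] (D : ModularParametrizationData W N)
    (hc : ¬ (3 : ℤ) ∣ D.maninConstant)
    (hper : ∃ u : ℚ, ‖(u : ℚ_[3])‖ = 1 ∧ W.realPeriodRat = u * plusPeriod D.f)
    {ℓ : ℕ} [Fact ℓ.Prime] (hcyc : IsCyclicKolyvaginLevel W 3 ℓ)
    (hF : Kato.IsKolyvaginPrime W 3 (s + padicValNat 3 W.tamagawaProduct + 1) ℓ)
    (hv : localDivExponent W 3 ℓ P = 0) :
    kuriharaPartial W 3 D.f 1 = ((s + padicValNat 3 W.tamagawaProduct : ℕ) : ℕ∞) :=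
  kuriharaPartial_one_eq_of_forall_kuriharaExactOrderAt W D.f P _
    (fun ℓ' hℓ' hcyc' k hk hℓ'k =>
      @hC W _ _ hr P hP hgen htors hsurj hgood ha1 ha2 hm q s hq hs N _ D hc hper ℓ' k ⟨hℓ'⟩ hk hℓ'k hcyc')
    hcyc hF hv

end Closed

section VanishingOrder

variable (W : WeierstrassCurve ℚ) [W.IsElliptic] [W.IsGloballyMinimal] {N : ℕ} [NeZero N]
  (D : ModularParametrizationData W N) (P : W.toAffine.Point) (F : ℕ)

/-- In analytic rank `≥ 1` the level-`1` Kurihara number vanishes to every depth: `δ̃_1 = [0]⁺_f =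
L(E,1)/Ω⁺_f = 0` (`kuriharaNumber_one`, `ratPlusSymbol_zero_eq_zero_of_entireLFunction_eq_zero`), so
`kuriharaDivIndex W 3 D.f 1 = ⊤`. [cite: Kim2022StructureSelmer, §1.4.3–1.4.4 (PDF p. 7)] -/
theorem kuriharaDivIndex_one_eq_top_of_analyticRank_ne_zero (hr : W.analyticRank ≠ 0) :
    kuriharaDivIndex W 3 D.f 1 = ⊤ := by
  have hE : W.HasEntireLFunction :=
    WeierstrassCurve.hasEntireLFunction_of_cuspCoeff_eq (strictWidthInfty_Gamma0 _) W D.f D.isNewformOf.2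
  have hL : W.entireLFunction 1 = 0 := by
    by_contra hne
    exact hr ((W.analyticRank_eq_zero_iff_holds hE).mpr hne)
  have hsym : ratPlusSymbol D.f 0 = 0 :=
    ratPlusSymbol_zero_eq_zero_of_entireLFunction_eq_zero D.isNewformOf hL
  have hdiv : ∀ j : ℕ, KuriharaDivisibleAt W 3 D.f 1 j := fun j =>
    (kuriharaDivisibleAt_one_iff W 3 D.f j).mpr fun k _ => by rw [hsym, ratModP_zero]
  refine ENat.eq_top_iff_forall_ge.mpr fun m => ?_
  exact le_kuriharaDivIndex_of_divisibleAt W 3 D.f (hdiv m)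

/-- **C-16 ⟹ `ord(δ̃) = 1 = r_an`** (the rank clause of Kim 2022 Thm. 1.9 (1), READ on the letter):
in analytic rank `1` the level `1` carries no non-zero Kurihara number (`kuriharaDivIndex … 1 = ⊤`), while
the law at ONE cyclic Kolyvagin prime `ℓ` read UNCAPPED (`F + 2·v_ℓ(P) < k′_ℓ`, e.g. `v_ℓ(P) = 0` and
`ℓ ∈ 𝒫_{F+1}`) gives a non-zero number at a `ν = 1` level. The prime is a hypothesis.
[cite: Kim2022StructureSelmer, §1.4.4 (PDF p. 7) and Thm. 1.9 (1) (PDF p. 8)] -/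
theorem kuriharaVanishingOrder_eq_one_of_forall_kuriharaExactOrderAt (hr : W.analyticRank ≠ 0)
    {ℓ : ℕ} [Fact ℓ.Prime] (hcyc : IsCyclicKolyvaginLevel W 3 ℓ)
    (hlaw : ∀ k, 1 ≤ k → Kato.IsKolyvaginPrime W 3 k ℓ → KuriharaExactOrderAt W D.f ℓ k P F)
    {k' : ℕ} (hk' : Kato.IsKolyvaginPrime W 3 k' ℓ) (hlt : F + 2 * localDivExponent W 3 ℓ P < k') :
    kuriharaVanishingOrder W 3 D.f = 1 := by
  have hℓp : ℓ.Prime := Fact.out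
  refine le_antisymm ?_ ?_
  · -- the witness prime: a `ν = 1` level with finite index
    have hidx : kuriharaDivIndex W 3 D.f ℓ < ⊤ := by
      rw [kuriharaDivIndex_eq_of_forall_kuriharaExactOrderAt W D.f ℓ P F hlaw hk' hlt]
      exact ENat.coe_lt_top _
    unfold kuriharaVanishingOrder
    refine iInf_le_of_le ℓ (iInf_le_of_le hcyc (iInf_le_of_le hidx ?_))
    rw [hℓp.primeFactors, Finset.card_singleton, Nat.cast_one]
  · -- no level with `ν = 0` (i.e. `n = 1`) has finite index
    unfold kuriharaVanishingOrder
    refine le_iInf fun n => le_iInf fun hn => le_iInf fun hidx => ?_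
    have hn1 : n ≠ 1 := by
      rintro rfl
      rw [kuriharaDivIndex_one_eq_top_of_analyticRank_ne_zero W D hr] at hidx
      exact lt_irrefl _ hidx
    have hne : n.primeFactors.Nonempty := Nat.nonempty_primeFactors.mpr (by
      have := hn.1.ne_zero; omega)
    exact_mod_cast Finset.card_pos.mpr hne

/-- **From the closed sentence: C-16 ⟹ `ord(δ̃) = 1`** on every curve of its letter with a cyclic
Kolyvagin prime `ℓ ∈ 𝒫_{F+1}`, `F = v₃ #Ш_an + v₃ ∏ c_q`, at which `v_ℓ(P) = 0` (a hypothesis).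
[cite: Kim2022StructureSelmer, §1.4.4 (PDF p. 7) and Thm. 1.9 (1) (PDF p. 8)] -/
theorem kuriharaVanishingOrder_eq_one_of_kuriharaExactOrderRankOne (hC : KuriharaExactOrderRankOneAtThree)
    (hr : W.analyticRank = 1) (hP : ¬ IsOfFinAddOrder P)
    (hgen : ∀ Q : W.toAffine.Point, ∃ n : ℤ, IsOfFinAddOrder (Q - n • P))
    (htors : ∀ T : W.toAffine.Point, 3 • T = 0 → T = 0) (hsurj : W.HasSurjectiveModNGaloisRep 3)
    (hgood : W.HasGoodReductionAtPrime 3) (ha1 : W.frobeniusTrace 3 ≠ 1) (ha2 : W.frobeniusTrace 3 ≠ -2)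
    (hm : ¬ O5.PointLocallyThreeDivisibleAt W 3 P) {q : ℚ} {s : ℕ} (hq : shaAn W = (q : ℂ))
    (hs : padicValRat 3 q = s) (hc : ¬ (3 : ℤ) ∣ D.maninConstant)
    (hper : ∃ u : ℚ, ‖(u : ℚ_[3])‖ = 1 ∧ W.realPeriodRat = u * plusPeriod D.f)
    {ℓ : ℕ} [Fact ℓ.Prime] (hcyc : IsCyclicKolyvaginLevel W 3 ℓ)
    (hF : Kato.IsKolyvaginPrime W 3 (s + padicValNat 3 W.tamagawaProduct + 1) ℓ)
    (hv : localDivExponent W 3 ℓ P = 0) : kuriharaVanishingOrder W 3 D.f = 1 :=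
  kuriharaVanishingOrder_eq_one_of_forall_kuriharaExactOrderAt W D P _ (by rw [hr]; exact one_ne_zero) hcyc
    (fun k hk hℓk => hC W hr P hP hgen htors hsurj hgood ha1 ha2 hm q s hq hs D hc hper ℓ k hk hℓk hcyc)
    hF (by rw [hv]; omega)

end VanishingOrder

section Parity

variable (W : WeierstrassCurve ℚ) [W.IsGloballyMinimal] {N : ℕ} (f : CuspForm (Gamma0 N) 2)
  (ℓ : ℕ) [Fact ℓ.Prime] (k : ℕ) (P : W.toAffine.Point) (F : ℕ)

/-- **The parity probe** (the owner's "cheapest partial probe" of KILL LETTER K-hyp-4, hyp §120): under the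
law at an UNCAPPED level (`F + 2·v_ℓ(P) < k`) the exact order is `≡ F (mod 2)` — on a FLOOR-even curve an
ODD exact order below the cap at any cyclic Kolyvagin prime refutes the law at that level, whatever
`v_ℓ(P)` is (no point arithmetic needed). [cite: Kim2022StructureSelmer, §1.4.3 (PDF p. 7)] -/
theorem zmodPowOrd_kuriharaNumber_mod_two_of_kuriharaExactOrderAt
    (hlaw : KuriharaExactOrderAt W f ℓ k P F) (hlt : F + 2 * localDivExponent W 3 ℓ P < k)
    (ψ : (q : ℕ) → (ZMod q)ˣ →* Multiplicative (ZMod (3 ^ k)))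
    (hψ : ∀ q ∈ ℓ.primeFactors, Function.Surjective (ψ q)) :
    haveI : NeZero ℓ := ⟨(Fact.out : ℓ.Prime).ne_zero⟩
    zmodPowOrd 3 k (kuriharaNumber f (3 ^ k) ℓ ψ) % 2 = F % 2 := by
  haveI : NeZero ℓ := ⟨(Fact.out : ℓ.Prime).ne_zero⟩
  have h := hlaw ψ hψ
  rw [min_eq_right hlt.le] at h
  rw [h]
  omega

end Parity

end Summit.BirchSwinnertonDyer.Rank1Residual.Ordinary

end
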